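import Summits.QuantumFields.YangMills.Theorems.SwapVirialDeficitBlowUpGnomonicRelationQuaternions
import Summits.QuantumFields.YangMills.Theorems.SwapVirialDeficitBlowUpGnomonicTr001Flat
import Summits.QuantumFields.YangMills.Theorems.SwapVirialDeficitBlowUpChartDeficitGrowthTwisted
import HarnessLib

/-!
# THE LETTER FLOORS OF SECTOR `001` IN THE TRANSLATED CHART: the anticommutator `AY′ + Y′A` sees `y⊥` AND the hub-polar letter, the commutator `[x̂, Y′]` sees the
# transverse `x`-combination `x₁y₀ + x₂` AND the axial tilt `x₀` — uniformly, hub-free (inputs (iii)/(v) of `stub_h001_good`, skeleton ➎ v8; free-hands support of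
# ⟨stmt-QuantumFields-24197⟩ `SwapVirialDeficit.SwapGluedStiffness`; LEAD sfw-p2 g99 division of labour 2026-08-31 21:38Z)

Sector `001` is read in the translated chart ✓`trGnoDeficit uJ z₁ (sectorChar z₁) a ε η` (✓`…TranslatedDefs`, ✓Defs §8–§9): leaders `C₀ = x̂`, `C₁ = Ā·x̂·A·ẑ`, `c = A`
as in the master chart (✓`trLeader_eq_of_ne_two`) and `C₂ = Q(j)·Q(ŷ)`, i.e. the quaternion `Y′ = j·Ŷ = ±(−y₁, y₂, 1, −y₀)/√(1+|y|²)`; the relations are the leader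
commutators, the UNTWISTED σ-relations `cC₁ = C₀c`, `cC₀ = C₁c` and the TWISTED one `cC₂ = −C₂c` (`centreElem (z₁ 2) = negOne`), each `≤ 52L³√F̂₁` in Frobenius norm
(w3 g65 ✓`chartBox_of_chartDeficit_twisted`), i.e. `≤ 1352L⁶F̂₁` in squared quaternion norm:
* §1 quaternion algebra: the translated letter `uJ·(±(1,y))` by components; the ANTIcommutator with an axial `p`: `‖pq + qp‖² = 4[(p₀q₀ − p₁q₁)² + (p₀q₁ + q₀p₁)² +
  p₀²(q_J² + q_K²)]`; all four components of a commutator;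
* §2 ★★ `bfar_tr_antiComm_sq` — `‖A·Y′ + Y′·A‖² = 4(y₁² + y₂²)/(1+|y|²) + 4(re a)²(1+y₀²)/(‖a‖²(1+|y|²))` (the twisted σ-relation sees `y⊥` AND the hub-polar letter,
  with UNIFORM coefficients: the 001 valley has no Σ), ★★ `bfar_tr_comm02_sq` — `‖x̂·Y′ − Y′·x̂‖² = 4[(x₁y₀ + x₂)² + (x₂y₂ + x₀y₀)² + (x₀ − x₁y₂)²]/((1+|x|²)(1+|y|²))`
  (the flat direction of the `x`-letter is `(0, 1, −y₀)`: fcl-p3 g47's ✓`xSkewRot (arctan y₀)`; the commutator sees the transverse combination AND the axial tilt, hub-FREE);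
* §3 chart level, EVERY hub `a ≠ 0`, EVERY sign pattern, ALL coordinates (`F̂₁ = trGnoDeficit uJ z₁ (sectorChar z₁) a ε η`): ★★★ `trDeficit_floor_sigma2`
  (`4|y⊥|²/(1+|y|²) + 4re(a)²(1+y₀²)/(‖a‖²(1+|y|²)) ≤ 1352L⁶F̂₁`), ★★★ `trDeficit_floor_comm02` (`4[(x₁y₀+x₂)² + (x₂y₂+x₀y₀)² + (x₀−x₁y₂)²]/((1+|x|²)(1+|y|²)) ≤ 1352L⁶F̂₁`),
  ★ `trDeficit_floor_z` (`|z|²/(1+|z|²) ≤ 1352L⁶F̂₁`), ★ `trDeficit_floor_followers` (`Σ_f|η_f|²/(1+|η_f|²) ≤ 1152L⁶|Fol L|F̂₁`), and the `y`-free master floors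
  transferred (`trDeficit_floor_hubPolar`, `trDeficit_floor_tilt`: constants `5408`, `13520`);
* §4 the hub `hubAt δ 1`: `trDeficit_floor_sigma2_hubAt` (`4|y⊥|²/(1+|y|²) + 4δ²(1+y₀²)/((1+δ²)(1+|y|²)) ≤ 1352L⁶F̂₁`).
So the eight transversal leader letters of the 001 valley `B₀₀₁` (`δ, x₀, x₁y₀ + x₂, y₁, y₂, z`) and all followers are each bounded by `poly(L)·F̂₁` with weights of
`(1+|x|²)⁻¹(1+|y|²)⁻¹`-type only — the 001 Morse–Bott valley is UNIFORMLY non-degenerate (LEAD memo7 §D), quantitatively.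

HONEST LABEL: quaternion bookkeeping on landed inequalities; the 001 chart equivalence (fcl-p3 g48), the 001 law and `stub_h001_good`, stubs B (closing) ∕ core-tip ∕ core-end,
⟨24197⟩ ∕ ⟨24194⟩ and every rung are OPEN; own crux ⟨22884⟩ `LargeFieldMassRefinementTail` OPEN (blocked-on ⟨19935⟩); no crux, rung of record or summit is proved;
the Yang–Mills mass gap is NOT proved; no summit is proved by a line.  THEOREMS ONLY (0 `def`, 0 `sorry`), standard axioms.  Width seat ym-line-sfw-p2-w3 g67
(cell ym-idea-1, free hands), `--supports stmt-QuantumFields-24197`.  References: [cite: Luscher1983, §2]; [cite: tHooft1979]; [folklore].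
-/

set_option autoImplicit false

noncomputable section

open MeasureTheory Quaternion
open scoped BigOperators Quaternion
open Literature.MathematicalPhysics.QuantumFieldTheory hiding SU2
open Literature.MathematicalPhysics.QuantumLattice
open Literature.Analysis.Calculus (radialUnit radialUnit_def norm_radialUnit)

namespace Summit.QuantumFields.YangMills.Theorems.SwapVirialDeficit.BlowUpRing

open Summit.QuantumFields.YangMills.Theorems.FemtoTransferGap
open Summit.QuantumFields.YangMills.Theorems.FemtoTransferGap.TT
open Summit.QuantumFields.YangMills.Theorems.FemtoTransferGap.TwoLattice.Flat (fd)
open Summit.QuantumFields.YangMills.Theorems.VirialFluxGap.RingDeficit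
open Summit.QuantumFields.YangMills.Theorems.SwapVirialDeficit.SwapRing
open Summit.QuantumFields.YangMills.Theorems.SwapTwistDeficit.ToronLog (axisPoint)
open Summit.QuantumFields.YangMills.Theorems.SwapVirialDeficit.ZeroModeSigma (norm_axisUnit su2Quat_quatToSU2_eq_radialUnit)
open Summit.QuantumFields.YangMills.Theorems.ToronValleyVolume.Lojasiewicz (fd_sq_eq_two_mul)
open Summit.QuantumFields.YangMills.Theorems.SwapVirialDeficit.SectorLaplace (z₁ uJ sectorChar sectorChar_eq uJ_ne_zero norm_uJ)
open Summit.QuantumFields.YangMills.Theorems.SwapVirialDeficit.OddSectorNoFlat (su2Quat_negOne_mul)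
open Summit.QuantumFields.YangMills.Theorems.SwapVirialDeficit.Gnomonic (su2Quat_trLeader_two trLeader_eq_of_ne_two trFollower_eq)

variable {L : ℕ} [NeZero L]

/-! ## §1 Quaternion algebra of the translated letter and the anticommutator -/

omit [NeZero L] in
/-- Components of the translated letter `j·(±(1,y)) = ±(−y₁, y₂, 1, −y₀)`. [folklore] -/
theorem bfar_trY_components (ε : Bool) (y : Fin 3 → ℝ) :
    (uJ * gnoLetter ε y).re = -(gnoSign ε * y 1) ∧ (uJ * gnoLetter ε y).imI = gnoSign ε * y 2 ∧ (uJ * gnoLetter ε y).imJ = gnoSign ε ∧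
      (uJ * gnoLetter ε y).imK = -(gnoSign ε * y 0) := by
  obtain ⟨h0, h1, h2, h3⟩ := bfar_gnoLetter_components ε y
  refine ⟨?_, ?_, ?_, ?_⟩ <;> simp [uJ, h0, h1, h2, h3]

omit [NeZero L] in
/-- `‖j·Y‖ = ‖Y‖`. [folklore] -/
theorem bfar_norm_uJ_mul (Y : ℍ) : ‖uJ * Y‖ = ‖Y‖ := by rw [norm_mul, norm_uJ, one_mul]

omit [NeZero L] in
/-- The ANTIcommutator with an axial `p` (`p_J = p_K = 0`): components `(2(p₀q₀ − p₁q₁), 2(p₀q₁ + q₀p₁), 2p₀q_J, 2p₀q_K)`. [folklore] -/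
theorem bfar_axial_antiComm (p q : ℍ) (hJ : p.imJ = 0) (hK : p.imK = 0) :
    (p * q + q * p).re = 2 * (p.re * q.re - p.imI * q.imI) ∧ (p * q + q * p).imI = 2 * (p.re * q.imI + q.re * p.imI) ∧
      (p * q + q * p).imJ = 2 * p.re * q.imJ ∧ (p * q + q * p).imK = 2 * p.re * q.imK := by
  refine ⟨?_, ?_, ?_, ?_⟩ <;> simp [hJ, hK] <;> ring

omit [NeZero L] in
/-- `‖pq + qp‖² = 4[(p₀q₀ − p₁q₁)² + (p₀q₁ + q₀p₁)² + p₀²(q_J² + q_K²)]` for an axial `p`. [folklore] -/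
theorem bfar_norm_axial_antiComm_sq (p q : ℍ) (hJ : p.imJ = 0) (hK : p.imK = 0) :
    ‖p * q + q * p‖ ^ 2 = 4 * ((p.re * q.re - p.imI * q.imI) ^ 2 + (p.re * q.imI + q.re * p.imI) ^ 2 + p.re ^ 2 * (q.imJ ^ 2 + q.imK ^ 2)) := by
  obtain ⟨h0, h1, h2, h3⟩ := bfar_axial_antiComm p q hJ hK
  rw [sq_norm_eq_sum_sq, h0, h1, h2, h3]; ring

omit [NeZero L] in
/-- All four components of a commutator: `re = 0`, `imI = 2(X_J W_K − X_K W_J)`, and the `(j,k)` ones of ✓`bfar_comm_imJK`. [folklore] -/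
theorem bfar_comm_components (X W : ℍ) :
    (X * W - W * X).re = 0 ∧ (X * W - W * X).imI = 2 * (X.imJ * W.imK - X.imK * W.imJ) ∧
      (X * W - W * X).imJ = 2 * (X.imK * W.imI - X.imI * W.imK) ∧ (X * W - W * X).imK = 2 * (X.imI * W.imJ - X.imJ * W.imI) := by
  refine ⟨?_, ?_, ?_, ?_⟩ <;> simp <;> ring

/-! ## §2 The two 001-specific relation quaternions -/

omit [NeZero L] in
/-- ★★ **THE TWISTED σ-RELATION SEES `y⊥` AND THE HUB-POLAR LETTER**: with `A = ν(axisPoint a)`, `Y′ = j·ν(±(1,y))`,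
`‖A·Y′ + Y′·A‖² = 4(y₁² + y₂²)/(1+|y|²) + 4·re(a)²·(1+y₀²)/(‖a‖²(1+|y|²))`. [cite: tHooft1979] [folklore] -/
theorem bfar_tr_antiComm_sq {a : ℍ} (ha : a ≠ 0) (ε : Bool) (y : Fin 3 → ℝ) :
    ‖radialUnit (axisPoint a) * (uJ * radialUnit (gnoLetter ε y)) + (uJ * radialUnit (gnoLetter ε y)) * radialUnit (axisPoint a)‖ ^ 2 =
      4 * ((y 1) ^ 2 + (y 2) ^ 2) / (1 + ((y 0) ^ 2 + (y 1) ^ 2 + (y 2) ^ 2)) +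
        4 * a.re ^ 2 * (1 + (y 0) ^ 2) / (‖a‖ ^ 2 * (1 + ((y 0) ^ 2 + (y 1) ^ 2 + (y 2) ^ 2))) := by
  have eY : uJ * radialUnit (gnoLetter ε y) = ‖gnoLetter ε y‖⁻¹ • (uJ * gnoLetter ε y) := by rw [radialUnit_def, mul_smul_comm]
  have e : radialUnit (axisPoint a) * (uJ * radialUnit (gnoLetter ε y)) + (uJ * radialUnit (gnoLetter ε y)) * radialUnit (axisPoint a) =
      (‖axisPoint a‖⁻¹ * ‖gnoLetter ε y‖⁻¹) • (axisPoint a * (uJ * gnoLetter ε y) + (uJ * gnoLetter ε y) * axisPoint a) := by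
    rw [eY, radialUnit_def]; ext <;> simp <;> ring
  rw [e, bfar_norm_smul_sq, bfar_norm_axial_antiComm_sq _ _ rfl rfl]
  obtain ⟨q0, q1, q2, q3⟩ := bfar_trY_components ε y
  rw [q0, q1, q2, q3, show (axisPoint a).imI = ‖a.im‖ from rfl, show (axisPoint a).re = a.re from rfl, mul_pow, inv_pow, inv_pow,
    bfar_norm_axisPoint_sq, bfar_norm_gnoLetter_sq]
  have ha' : 0 < ‖a‖ ^ 2 := by positivity
  have hY : 0 < 1 + ((y 0) ^ 2 + (y 1) ^ 2 + (y 2) ^ 2) := by positivity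
  have han : ‖a‖ ^ 2 = a.re ^ 2 + ‖a.im‖ ^ 2 := by
    rw [← bfar_norm_axisPoint_sq, ZeroModeGroup.norm_sq_axis (axisPoint a) rfl rfl]; rfl
  have hane : a.re ^ 2 + ‖a.im‖ ^ 2 ≠ 0 := by rw [← han]; exact ha'.ne'
  rw [han]
  rcases (show gnoSign ε = 1 ∨ gnoSign ε = -1 by cases ε <;> simp [gnoSign]) with h | h
  · rw [h]; field_simp; ring
  · rw [h]; field_simp; ring

omit [NeZero L] in
/-- ★★ **THE `C₀`–`C₂` COMMUTATOR SEES THE TRANSVERSE `x`-COMBINATION AND THE AXIAL TILT** (hub-free): with `x̂ = ν(±(1,x))`, `Y′ = j·ν(±(1,y))`,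
`‖x̂·Y′ − Y′·x̂‖² = 4[(x₁y₀ + x₂)² + (x₂y₂ + x₀y₀)² + (x₀ − x₁y₂)²]/((1+|x|²)(1+|y|²))`. [folklore] -/
theorem bfar_tr_comm02_sq (εx εy : Bool) (x y : Fin 3 → ℝ) :
    ‖radialUnit (gnoLetter εx x) * (uJ * radialUnit (gnoLetter εy y)) - (uJ * radialUnit (gnoLetter εy y)) * radialUnit (gnoLetter εx x)‖ ^ 2 =
      4 * ((x 1 * y 0 + x 2) ^ 2 + (x 2 * y 2 + x 0 * y 0) ^ 2 + (x 0 - x 1 * y 2) ^ 2) /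
        ((1 + ((x 0) ^ 2 + (x 1) ^ 2 + (x 2) ^ 2)) * (1 + ((y 0) ^ 2 + (y 1) ^ 2 + (y 2) ^ 2))) := by
  have eY : uJ * radialUnit (gnoLetter εy y) = ‖gnoLetter εy y‖⁻¹ • (uJ * gnoLetter εy y) := by rw [radialUnit_def, mul_smul_comm]
  rw [eY, radialUnit_def, bfar_comm_smul, bfar_norm_smul_sq]
  obtain ⟨c0, c1, c2, c3⟩ := bfar_comm_components (gnoLetter εx x) (uJ * gnoLetter εy y)
  obtain ⟨q0, q1, q2, q3⟩ := bfar_trY_components εy y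
  obtain ⟨p0, p1, p2, p3⟩ := bfar_gnoLetter_components εx x
  rw [sq_norm_eq_sum_sq (gnoLetter εx x * (uJ * gnoLetter εy y) - uJ * gnoLetter εy y * gnoLetter εx x), c0, c1, c2, c3, q1, q2, q3, p1, p2, p3,
    mul_pow, inv_pow, inv_pow, bfar_norm_gnoLetter_sq, bfar_norm_gnoLetter_sq]
  have hX : 0 < 1 + ((x 0) ^ 2 + (x 1) ^ 2 + (x 2) ^ 2) := by positivity
  have hY : 0 < 1 + ((y 0) ^ 2 + (y 1) ^ 2 + (y 2) ^ 2) := by positivity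
  rcases (show gnoSign εx = 1 ∨ gnoSign εx = -1 by cases εx <;> simp [gnoSign]) with h | h <;>
    rcases (show gnoSign εy = 1 ∨ gnoSign εy = -1 by cases εy <;> simp [gnoSign]) with h' | h' <;>
    · rw [h, h']; field_simp; ring

/-! ## §3 Chart level: the 001 letter floors at every hub `a ≠ 0` -/

/-- Squared twisted box bound for a commutator, through `su2Quat`: `‖q(C_μC_ν) − q(C_νC_μ)‖² ≤ 1352L⁶F̂_z`. [cite: Luscher1983, §2] -/
theorem bfar_tw_comm_quat_sq_le (z : Fin 3 → Bool) (q : (Fin 4 → SU2) × (Fol L → SU2)) (μ ν : Fin 3) :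
    ‖su2Quat (q.1 (Fin.castSucc μ) * q.1 (Fin.castSucc ν)) - su2Quat (q.1 (Fin.castSucc ν) * q.1 (Fin.castSucc μ))‖ ^ 2 ≤
      1352 * (L : ℝ) ^ 6 * chartDeficit L z (sectorChar z) q := by
  rw [sectorChar_eq]
  obtain ⟨hC, -, -⟩ := chartBox_of_chartDeficit_twisted (L := L) z q
  have hF := chartDeficit_nonneg z
    (fun x => centreElem (Bool.xor (z 0 && decide (x 0 ≠ 0)) (Bool.xor (z 1 && decide (x 1 ≠ 0)) (z 2 && decide (x 2 ≠ 0))))) q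
  have h := sq_le_sq_mul_of_le_mul_sqrt (frobNorm_nonneg _) hF (hC μ ν)
  have hfd : fd (q.1 (Fin.castSucc μ) * q.1 (Fin.castSucc ν)) (q.1 (Fin.castSucc ν) * q.1 (Fin.castSucc μ)) =
      frobNorm (((q.1 (Fin.castSucc μ) * q.1 (Fin.castSucc ν) : SU2) : Matrix (Fin 2) (Fin 2) ℂ) -
        ((q.1 (Fin.castSucc ν) * q.1 (Fin.castSucc μ) : SU2) : Matrix (Fin 2) (Fin 2) ℂ)) := by simp only [fd]
  have e := fd_sq_eq_two_mul (q.1 (Fin.castSucc μ) * q.1 (Fin.castSucc ν)) (q.1 (Fin.castSucc ν) * q.1 (Fin.castSucc μ))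
  rw [hfd] at e
  nlinarith [h, e]

/-- Squared twisted box bound for a signed σ-relation, through `su2Quat`: `‖q(c·C_{σμ}) − q(centreElem(z μ)·C_μ·c)‖² ≤ 1352L⁶F̂_z`. [cite: Luscher1983, §2] -/
theorem bfar_tw_sigma_quat_sq_le (z : Fin 3 → Bool) (q : (Fin 4 → SU2) × (Fol L → SU2)) (μ : Fin 3) :
    ‖su2Quat (q.1 (Fin.last 3) * q.1 (Fin.castSucc (Equiv.swap (0 : Fin 3) 1 μ))) - su2Quat (centreElem (z μ) * q.1 (Fin.castSucc μ) * q.1 (Fin.last 3))‖ ^ 2 ≤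
      1352 * (L : ℝ) ^ 6 * chartDeficit L z (sectorChar z) q := by
  rw [sectorChar_eq]
  obtain ⟨-, hσ, -⟩ := chartBox_of_chartDeficit_twisted (L := L) z q
  have hF := chartDeficit_nonneg z
    (fun x => centreElem (Bool.xor (z 0 && decide (x 0 ≠ 0)) (Bool.xor (z 1 && decide (x 1 ≠ 0)) (z 2 && decide (x 2 ≠ 0))))) q
  have h := sq_le_sq_mul_of_le_mul_sqrt (frobNorm_nonneg _) hF (hσ μ)
  have hfd : fd (q.1 (Fin.last 3) * q.1 (Fin.castSucc (Equiv.swap (0 : Fin 3) 1 μ))) (centreElem (z μ) * q.1 (Fin.castSucc μ) * q.1 (Fin.last 3)) =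
      frobNorm (((q.1 (Fin.last 3) * q.1 (Fin.castSucc (Equiv.swap (0 : Fin 3) 1 μ)) : SU2) : Matrix (Fin 2) (Fin 2) ℂ) -
        ((centreElem (z μ) * q.1 (Fin.castSucc μ) * q.1 (Fin.last 3) : SU2) : Matrix (Fin 2) (Fin 2) ℂ)) := by simp only [fd]
  have e := fd_sq_eq_two_mul (q.1 (Fin.last 3) * q.1 (Fin.castSucc (Equiv.swap (0 : Fin 3) 1 μ))) (centreElem (z μ) * q.1 (Fin.castSucc μ) * q.1 (Fin.last 3))
  rw [hfd] at e
  nlinarith [h, e]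

/-- ★★★ **(σ2′) THE TWISTED RELATION FLOOR OF SECTOR 001**: at every hub `a ≠ 0`, every sign pattern, all coordinates,
`4(y₁² + y₂²)/(1+|y|²) + 4re(a)²(1+y₀²)/(‖a‖²(1+|y|²)) ≤ 1352·L⁶·F̂₁`, `F̂₁ = trGnoDeficit uJ z₁ (sectorChar z₁) a ε η`. [cite: tHooft1979] [cite: Luscher1983, §2] -/
theorem trDeficit_floor_sigma2 {a : ℍ} (ha : a ≠ 0) (ε : GnoSign L) (η : GnoCoord L) :
    4 * ((η.1.2 1) ^ 2 + (η.1.2 2) ^ 2) / (1 + ((η.1.2 0) ^ 2 + (η.1.2 1) ^ 2 + (η.1.2 2) ^ 2)) +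
        4 * a.re ^ 2 * (1 + (η.1.2 0) ^ 2) / (‖a‖ ^ 2 * (1 + ((η.1.2 0) ^ 2 + (η.1.2 1) ^ 2 + (η.1.2 2) ^ 2))) ≤
      1352 * (L : ℝ) ^ 6 * trGnoDeficit uJ z₁ (sectorChar z₁) a ε η := by
  unfold trGnoDeficit
  have h := bfar_tw_sigma_quat_sq_le (L := L) z₁ (blowUpPoint (L := L) 1 (trGnomonicPoint uJ a ε η)) 2
  rw [Equiv.swap_apply_of_ne_of_ne (by decide) (by decide), show centreElem (z₁ 2) = negOne from rfl,
    Balaban1983to89.T4HaarSU2Translate.su2Quat_mul, Balaban1983to89.T4HaarSU2Translate.su2Quat_mul, su2Quat_negOne_mul,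
    show (Fin.castSucc (2 : Fin 3) : Fin 4) = 2 from rfl, show (Fin.last 3 : Fin 4) = 3 from rfl] at h
  obtain ⟨-, -, h2, h3⟩ := su2Quat_trLeaders (L := L) ha ε η
  rw [h2, h3, neg_mul, sub_neg_eq_add, bfar_tr_antiComm_sq ha] at h
  exact h

/-- ★★★ **(c02′) THE `C₀`–`C₂` COMMUTATOR FLOOR OF SECTOR 001** (hub-free): every hub, every sign pattern, all coordinates,
`4[(x₁y₀ + x₂)² + (x₂y₂ + x₀y₀)² + (x₀ − x₁y₂)²]/((1+|x|²)(1+|y|²)) ≤ 1352·L⁶·F̂₁`. [cite: Luscher1983, §2] -/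
theorem trDeficit_floor_comm02 {a : ℍ} (ha : a ≠ 0) (ε : GnoSign L) (η : GnoCoord L) :
    4 * ((η.1.1 1 * η.1.2 0 + η.1.1 2) ^ 2 + (η.1.1 2 * η.1.2 2 + η.1.1 0 * η.1.2 0) ^ 2 + (η.1.1 0 - η.1.1 1 * η.1.2 2) ^ 2) /
        ((1 + ((η.1.1 0) ^ 2 + (η.1.1 1) ^ 2 + (η.1.1 2) ^ 2)) * (1 + ((η.1.2 0) ^ 2 + (η.1.2 1) ^ 2 + (η.1.2 2) ^ 2))) ≤
      1352 * (L : ℝ) ^ 6 * trGnoDeficit uJ z₁ (sectorChar z₁) a ε η := by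
  unfold trGnoDeficit
  have h := bfar_tw_comm_quat_sq_le (L := L) z₁ (blowUpPoint (L := L) 1 (trGnomonicPoint uJ a ε η)) 0 2
  rw [Balaban1983to89.T4HaarSU2Translate.su2Quat_mul, Balaban1983to89.T4HaarSU2Translate.su2Quat_mul,
    show (Fin.castSucc (2 : Fin 3) : Fin 4) = 2 from rfl, show (Fin.castSucc (0 : Fin 3) : Fin 4) = 0 from rfl] at h
  obtain ⟨h0, -, h2, -⟩ := su2Quat_trLeaders (L := L) ha ε η
  rw [h0, h2, bfar_tr_comm02_sq] at h
  exact h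

/-- ★ **(σ0) THE σ-SLAVING LETTER IN SECTOR 001**: `|z|²/(1+|z|²) ≤ 1352·L⁶·F̂₁` (the `μ = 0` relation is untwisted and its leaders are the master ones). [cite: Luscher1983, §2] -/
theorem trDeficit_floor_z {a : ℍ} (ha : a ≠ 0) (ε : GnoSign L) (η : GnoCoord L) :
    ((η.2.1 0) ^ 2 + (η.2.1 1) ^ 2 + (η.2.1 2) ^ 2) / (1 + ((η.2.1 0) ^ 2 + (η.2.1 1) ^ 2 + (η.2.1 2) ^ 2)) ≤
      1352 * (L : ℝ) ^ 6 * trGnoDeficit uJ z₁ (sectorChar z₁) a ε η := by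
  unfold trGnoDeficit
  have h := bfar_tw_sigma_quat_sq_le (L := L) z₁ (blowUpPoint (L := L) 1 (trGnomonicPoint uJ a ε η)) 0
  rw [Equiv.swap_apply_left, show centreElem (z₁ 0) = (1 : SU2) from rfl, one_mul,
    show (Fin.castSucc (1 : Fin 3) : Fin 4) = 1 from rfl, show (Fin.castSucc (0 : Fin 3) : Fin 4) = 0 from rfl, show (Fin.last 3 : Fin 4) = 3 from rfl,
    trLeader_eq_of_ne_two uJ a ε η (show (3 : Fin 4) ≠ 2 by decide), trLeader_eq_of_ne_two uJ a ε η (show (1 : Fin 4) ≠ 2 by decide),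
    trLeader_eq_of_ne_two uJ a ε η (show (0 : Fin 4) ≠ 2 by decide), norm_sigmaRel_zero_quat ha ε η] at h
  exact (bfar_norm_radialUnit_gnoLetter_sub_one_sq_ge ε.2.1 η.2.1).trans h

/-- ★ **(followers) IN SECTOR 001**: `Σ_f |η_f|²/(1+|η_f|²) ≤ 1152·L⁶·|Fol L|·F̂₁`. [cite: Luscher1983, §2] -/
theorem trDeficit_floor_followers (a : ℍ) (ε : GnoSign L) (η : GnoCoord L) :
    ∑ i : Fol L, ((η.2.2 i 0) ^ 2 + (η.2.2 i 1) ^ 2 + (η.2.2 i 2) ^ 2) / (1 + ((η.2.2 i 0) ^ 2 + (η.2.2 i 1) ^ 2 + (η.2.2 i 2) ^ 2)) ≤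
      1152 * (L : ℝ) ^ 6 * (Fintype.card (Fol L) : ℝ) * trGnoDeficit uJ z₁ (sectorChar z₁) a ε η := by
  unfold trGnoDeficit
  rw [sectorChar_eq]
  have hfol := sum_follower_frobNorm_sq_le_chartDeficit_twisted (L := L) z₁ (blowUpPoint (L := L) 1 (trGnomonicPoint uJ a ε η))
  have key : ∀ i : Fol L, ((η.2.2 i 0) ^ 2 + (η.2.2 i 1) ^ 2 + (η.2.2 i 2) ^ 2) / (1 + ((η.2.2 i 0) ^ 2 + (η.2.2 i 1) ^ 2 + (η.2.2 i 2) ^ 2)) ≤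
      (1 / 2 : ℝ) * frobNorm ((((blowUpPoint (L := L) 1 (trGnomonicPoint uJ a ε η)).2 i : SU2) : Matrix (Fin 2) (Fin 2) ℂ) - 1) ^ 2 := fun i => by
    have hfd : fd ((blowUpPoint (L := L) 1 (trGnomonicPoint uJ a ε η)).2 i) 1 =
        frobNorm ((((blowUpPoint (L := L) 1 (trGnomonicPoint uJ a ε η)).2 i : SU2) : Matrix (Fin 2) (Fin 2) ℂ) - 1) := by
      simp only [fd, OneMemClass.coe_one]
    have e := fd_sq_eq_two_mul ((blowUpPoint (L := L) 1 (trGnomonicPoint uJ a ε η)).2 i) 1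
    rw [hfd, trFollower_eq, gnoFollower_eq a ε η i, su2Quat_quatToSU2_eq_radialUnit (gnoLetter_ne_zero _ _), su2Quat_one] at e
    have hge := bfar_norm_radialUnit_gnoLetter_sub_one_sq_ge (ε.2.2 i) (η.2.2 i)
    rw [trFollower_eq, gnoFollower_eq a ε η i]
    linarith
  calc ∑ i : Fol L, ((η.2.2 i 0) ^ 2 + (η.2.2 i 1) ^ 2 + (η.2.2 i 2) ^ 2) / (1 + ((η.2.2 i 0) ^ 2 + (η.2.2 i 1) ^ 2 + (η.2.2 i 2) ^ 2))
      ≤ ∑ i : Fol L, (1 / 2 : ℝ) * frobNorm ((((blowUpPoint (L := L) 1 (trGnomonicPoint uJ a ε η)).2 i : SU2) : Matrix (Fin 2) (Fin 2) ℂ) - 1) ^ 2 :=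
        Finset.sum_le_sum fun i _ => key i
    _ = (1 / 2 : ℝ) * ∑ i : Fol L, frobNorm ((((blowUpPoint (L := L) 1 (trGnomonicPoint uJ a ε η)).2 i : SU2) : Matrix (Fin 2) (Fin 2) ℂ) - 1) ^ 2 := by
        rw [Finset.mul_sum]
    _ ≤ (1 / 2 : ℝ) * (2304 * (L : ℝ) ^ 6 * (Fintype.card (Fol L) : ℝ) * chartDeficit L z₁
          (fun x => centreElem (Bool.xor (z₁ 0 && decide (x 0 ≠ 0)) (Bool.xor (z₁ 1 && decide (x 1 ≠ 0)) (z₁ 2 && decide (x 2 ≠ 0)))))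
          (blowUpPoint (L := L) 1 (trGnomonicPoint uJ a ε η))) := mul_le_mul_of_nonneg_left hfol (by norm_num)
    _ = _ := by ring

/-- ★ **(δ via the word `Ā[A², x̂]`) IN SECTOR 001** — the `y`-free hub-polar floor of the master chart, transferred (twisted box constant):
`16re(a)²‖im a‖²·(x₁² + x₂²)/(‖a‖⁴(1+|x|²)) ≤ 5408·L⁶·F̂₁`. [cite: Luscher1983, §2] -/
theorem trDeficit_floor_hubPolar {a : ℍ} (ha : a ≠ 0) (ε : GnoSign L) (η : GnoCoord L) :
    16 * a.re ^ 2 * ‖a.im‖ ^ 2 * ((η.1.1 1) ^ 2 + (η.1.1 2) ^ 2) / ((‖a‖ ^ 2) ^ 2 * (1 + ((η.1.1 0) ^ 2 + (η.1.1 1) ^ 2 + (η.1.1 2) ^ 2))) ≤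
      5408 * (L : ℝ) ^ 6 * trGnoDeficit uJ z₁ (sectorChar z₁) a ε η := by
  unfold trGnoDeficit
  -- (σ0) and (σ1) at the translated point, leaders `0,1,3` = master's
  have h0 := bfar_tw_sigma_quat_sq_le (L := L) z₁ (blowUpPoint (L := L) 1 (trGnomonicPoint uJ a ε η)) 0
  rw [Equiv.swap_apply_left, show centreElem (z₁ 0) = (1 : SU2) from rfl, one_mul,
    show (Fin.castSucc (1 : Fin 3) : Fin 4) = 1 from rfl, show (Fin.castSucc (0 : Fin 3) : Fin 4) = 0 from rfl, show (Fin.last 3 : Fin 4) = 3 from rfl,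
    trLeader_eq_of_ne_two uJ a ε η (show (3 : Fin 4) ≠ 2 by decide), trLeader_eq_of_ne_two uJ a ε η (show (1 : Fin 4) ≠ 2 by decide),
    trLeader_eq_of_ne_two uJ a ε η (show (0 : Fin 4) ≠ 2 by decide), norm_sigmaRel_zero_quat ha ε η] at h0
  have h1 := bfar_tw_sigma_quat_sq_le (L := L) z₁ (blowUpPoint (L := L) 1 (trGnomonicPoint uJ a ε η)) 1
  rw [Equiv.swap_apply_right, show centreElem (z₁ 1) = (1 : SU2) from rfl, one_mul,
    show (Fin.castSucc (1 : Fin 3) : Fin 4) = 1 from rfl, show (Fin.castSucc (0 : Fin 3) : Fin 4) = 0 from rfl, show (Fin.last 3 : Fin 4) = 3 from rfl,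
    trLeader_eq_of_ne_two uJ a ε η (show (3 : Fin 4) ≠ 2 by decide), trLeader_eq_of_ne_two uJ a ε η (show (1 : Fin 4) ≠ 2 by decide),
    trLeader_eq_of_ne_two uJ a ε η (show (0 : Fin 4) ≠ 2 by decide), Balaban1983to89.T4HaarSU2Translate.su2Quat_mul,
    Balaban1983to89.T4HaarSU2Translate.su2Quat_mul, su2Quat_gnoLeader_three ha, su2Quat_gnoLeader_zero, su2Quat_gnoLeader_one ha] at h1
  have hap : axisPoint a ≠ 0 := fun h => by
    have e := bfar_norm_axisPoint_sq a
    rw [h, norm_zero] at e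
    exact ha (norm_eq_zero.1 (by nlinarith [norm_nonneg a]))
  have hA1 : ‖radialUnit (axisPoint a)‖ = 1 := norm_radialUnit hap
  have hx1 : ‖radialUnit (gnoLetter ε.1.1 η.1.1)‖ = 1 := norm_radialUnit (gnoLetter_ne_zero _ _)
  have hle := bfar_sigmaRel_one_norm_le hA1 hx1 (radialUnit (gnoLetter ε.2.1 η.2.1))
  have hsq := pow_le_pow_left₀ (norm_nonneg _) hle 2
  rw [bfar_sqComm_sq ha ε.1.1 η.1.1] at hsq
  nlinarith [h0, h1, hsq, sq_nonneg (‖radialUnit (axisPoint a) * radialUnit (gnoLetter ε.1.1 η.1.1) -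
      star (radialUnit (axisPoint a)) * radialUnit (gnoLetter ε.1.1 η.1.1) * radialUnit (axisPoint a) * radialUnit (gnoLetter ε.2.1 η.2.1) *
        radialUnit (axisPoint a)‖ - ‖radialUnit (gnoLetter ε.2.1 η.2.1) - 1‖)]

/-- ★ **(x₀ via `[C₀, C₁]`) IN SECTOR 001** — the `y`-free axial-tilt floor of the master chart, transferred: `16‖im a‖²·x₀²(x₁² + x₂²)/(‖a‖²(1+|x|²)²) ≤ 13520·L⁶·F̂₁`.
[cite: Luscher1983, §2] -/
theorem trDeficit_floor_tilt {a : ℍ} (ha : a ≠ 0) (ε : GnoSign L) (η : GnoCoord L) :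
    16 * ‖a.im‖ ^ 2 * (η.1.1 0) ^ 2 * ((η.1.1 1) ^ 2 + (η.1.1 2) ^ 2) / (‖a‖ ^ 2 * (1 + ((η.1.1 0) ^ 2 + (η.1.1 1) ^ 2 + (η.1.1 2) ^ 2)) ^ 2) ≤
      13520 * (L : ℝ) ^ 6 * trGnoDeficit uJ z₁ (sectorChar z₁) a ε η := by
  unfold trGnoDeficit
  have h0 := bfar_tw_sigma_quat_sq_le (L := L) z₁ (blowUpPoint (L := L) 1 (trGnomonicPoint uJ a ε η)) 0
  rw [Equiv.swap_apply_left, show centreElem (z₁ 0) = (1 : SU2) from rfl, one_mul,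
    show (Fin.castSucc (1 : Fin 3) : Fin 4) = 1 from rfl, show (Fin.castSucc (0 : Fin 3) : Fin 4) = 0 from rfl, show (Fin.last 3 : Fin 4) = 3 from rfl,
    trLeader_eq_of_ne_two uJ a ε η (show (3 : Fin 4) ≠ 2 by decide), trLeader_eq_of_ne_two uJ a ε η (show (1 : Fin 4) ≠ 2 by decide),
    trLeader_eq_of_ne_two uJ a ε η (show (0 : Fin 4) ≠ 2 by decide), norm_sigmaRel_zero_quat ha ε η] at h0
  have h01 := bfar_tw_comm_quat_sq_le (L := L) z₁ (blowUpPoint (L := L) 1 (trGnomonicPoint uJ a ε η)) 0 1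
  rw [show (Fin.castSucc (1 : Fin 3) : Fin 4) = 1 from rfl, show (Fin.castSucc (0 : Fin 3) : Fin 4) = 0 from rfl,
    trLeader_eq_of_ne_two uJ a ε η (show (1 : Fin 4) ≠ 2 by decide), trLeader_eq_of_ne_two uJ a ε η (show (0 : Fin 4) ≠ 2 by decide),
    Balaban1983to89.T4HaarSU2Translate.su2Quat_mul, Balaban1983to89.T4HaarSU2Translate.su2Quat_mul, su2Quat_gnoLeader_zero,
    su2Quat_gnoLeader_one ha] at h01
  have hap : axisPoint a ≠ 0 := fun h => by
    have e := bfar_norm_axisPoint_sq a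
    rw [h, norm_zero] at e
    exact ha (norm_eq_zero.1 (by nlinarith [norm_nonneg a]))
  have hA1 : ‖radialUnit (axisPoint a)‖ = 1 := norm_radialUnit hap
  have hx1 : ‖radialUnit (gnoLetter ε.1.1 η.1.1)‖ = 1 := norm_radialUnit (gnoLetter_ne_zero _ _)
  have hP1 : ‖star (radialUnit (axisPoint a)) * radialUnit (gnoLetter ε.1.1 η.1.1) * radialUnit (axisPoint a)‖ = 1 := by
    rw [norm_mul, norm_mul, norm_star, hA1, hx1]; ring
  have hle := bfar_comm_zero_one_norm_le hx1 hP1 (radialUnit (gnoLetter ε.2.1 η.2.1))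
  have hsq := pow_le_pow_left₀ (norm_nonneg _) hle 2
  have hge := bfar_comm_conj_sq_ge ha ε.1.1 η.1.1
  nlinarith [h0, h01, hsq, hge, sq_nonneg (2 * ‖radialUnit (gnoLetter ε.1.1 η.1.1) *
        (star (radialUnit (axisPoint a)) * radialUnit (gnoLetter ε.1.1 η.1.1) * radialUnit (axisPoint a) * radialUnit (gnoLetter ε.2.1 η.2.1)) -
      star (radialUnit (axisPoint a)) * radialUnit (gnoLetter ε.1.1 η.1.1) * radialUnit (axisPoint a) * radialUnit (gnoLetter ε.2.1 η.2.1) *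
        radialUnit (gnoLetter ε.1.1 η.1.1)‖ - ‖radialUnit (gnoLetter ε.2.1 η.2.1) - 1‖)]

/-! ## §4 The hub `hubAt δ 1` -/

/-- ★★★ **(σ2′) AT THE HUB `hubAt δ 1`**: `4|y⊥|²/(1+|y|²) + 4δ²(1+y₀²)/((1+δ²)(1+|y|²)) ≤ 1352·L⁶·F̂₁` — the twisted relation floors BOTH transverse `y`-letters
AND the hub-polar letter with uniform coefficients. [cite: tHooft1979] [cite: Luscher1983, §2] -/
theorem trDeficit_floor_sigma2_hubAt (δ : ℝ) (ε : GnoSign L) (η : GnoCoord L) :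
    4 * ((η.1.2 1) ^ 2 + (η.1.2 2) ^ 2) / (1 + ((η.1.2 0) ^ 2 + (η.1.2 1) ^ 2 + (η.1.2 2) ^ 2)) +
        4 * δ ^ 2 * (1 + (η.1.2 0) ^ 2) / ((1 + δ ^ 2) * (1 + ((η.1.2 0) ^ 2 + (η.1.2 1) ^ 2 + (η.1.2 2) ^ 2))) ≤
      1352 * (L : ℝ) ^ 6 * trGnoDeficit uJ z₁ (sectorChar z₁) (hubAt δ 1) ε η := by
  have h := trDeficit_floor_sigma2 (L := L) (hubAt_one_ne_zero δ) ε η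
  obtain ⟨-, hre, -, hn2⟩ := bfar_hubAt_facts δ
  rw [hre, hn2] at h
  exact h

end Summit.QuantumFields.YangMills.Theorems.SwapVirialDeficit.BlowUpRing

end
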